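import Literature.IUT.HodgeTheaters.AutHolSpaceNFEquivariantPushMain
import Literature.IUT.HodgeTheaters.ThetaHodgeTheatersRemarksA2
import Mathlib.Tactic.Group
import HarnessLib

/-!
# [IUTchI] Rmk 3.4.3 (ii): the typed reading `NFPointsFunctorial` FAILS at the genuine model
# (kernel witness; typing finding, with the repaired reading)

S. Mochizuki, *Inter-universal Teichmüller theory I*, §3, Remark 3.4.3 (ii), kurims p. 83: "the set of
NF-points [i.e., points defined over a number field] of the underlying topological space of the
Aut-holomorphic space `D_v` may be reconstructed via a functorial algorithm from the [abstract]
Aut-holomorphic space `D_v`" [cite: Mochizuki2012, Rmk 3.4.3 (ii) p.83] [claim: Mochizuki2012, status: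
disputed].

FINDING (abc-iut cell, seat abc-iut-L6-t15 gen 4; class MISSTATED-AS-TYPED, not a claim about print).
The cell's typing (`ThetaHodgeTheatersRemarksA2.lean`, abc-iut-L3-t8) records an Aut-holomorphic space
as `(carrier, autHol : Subgroup (carrier ≃ₜ carrier), nfPoints)` — ONE group of global
self-homeomorphisms — and reads the remark as `NFPointsFunctorial X Y`: every homeomorphism `α`
with `φ ∈ autHol ↔ α⁻¹ ∘ φ ∘ α ∈ autHol` (`AutHolSpaceNF.IsIso`) carries `nfPoints` onto `nfPoints`.
At the GENUINE model `X` of `AutHolSpaceNFNonVacuity.lean` — the hyperbolic curve `P¹_ℚ ∖ {0,1,∞}`: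
carrier `ℂ ∖ {0,1}`, `autHol = Aut^hol(ℂ ∖ {0,1})` (abc-iut-L4 `holAut`), `nfPoints` = `ℚ̄`-points —
this is FALSE:

* `S3RemarksLocal.AutHolSpaceNF.not_nfPointsFunctorial_model : ¬ NFPointsFunctorial X X`.

Witness: `Aut^hol(ℂ ∖ {0,1})` is the FINITE anharmonic group `S₃` (classical,
`ThricePuncturedSphereAutomorphisms`), and the `S₃`-equivariant point-push `α` of
`AutHolSpaceNFEquivariantPushMain` commutes with all of it — so it is an `IsIso` in the typed sense —
yet moves the NF-point `3` to the non-algebraic point `3 + ξ/10`, `ξ = liouvilleNumber 10`.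

REPAIRED READING C′ (what print means; NOT proved here): an "isomorphism of Aut-holomorphic spaces"
in [AbsTopIII] Def. 2.1 (i)(ii) respects the full Aut-holomorphic STRUCTURE — the assignment
`W ↦ Aut^hol(W)` on ALL connected open subsets (abc-iut-L4 `AutHolStructure.ofCharted`,
`IsMorphism`) — not merely the global group; by [AbsTopIII] Cor. 2.3 (i) such an `α` is then
holomorphic or anti-holomorphic, and the witness `α` above (not even real-analytic) is NOT of that kind:
`C′ := ∀ α : X ≃ₜ Y, IsMorphism (ofCharted X) (ofCharted Y) α → IsMorphism (ofCharted Y) (ofCharted X)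
α.symm → α '' nfPoints X = nfPoints Y` over the L4 carrier.  The plan's node IUTchI:Rmk3.4.3(ii)
already carries «merge → abc-iut-L4-t2 AutHolStructure»; this file makes the need kernel-visible.
No definition is declared; nothing here takes a side on [IUTchIII] Cor. 3.12 or asserts anything of
[IUTchI]; a refutation of a TYPING is not a refutation of the printed remark.
-/

noncomputable section

namespace Literature.IUT.HodgeTheaters

open _root_.TopologicalSpace (Opens)
open Literature.AnabelianGeometry.AbsoluteAnabelian

/-- **[IUTchI] Rmk 3.4.3 (ii), typed reading, FAILS at the genuine model.**  For the Aut-holomorphic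
space `X` of `P¹_ℚ ∖ {0,1,∞}` (carrier `ℂ ∖ {0,1}`, `autHol := holAut`, `nfPoints :=` the `ℚ̄`-points —
the model of `S3RemarksLocal.AutHolSpaceNF.nonempty_model`), `NFPointsFunctorial X X` is false: the
`Aut^hol`-equivariant point-push is an `IsIso X X` (it commutes with the finite group
`Aut^hol(ℂ ∖ {0,1}) = S₃`) but maps the NF-point `3` to the transcendental point `3 + liouvilleNumber 10 / 10`.
MISSTATED-AS-TYPED; repaired reading C′ = isomorphisms of the full Aut-holomorphic structure
(abc-iut-L4 `AutHolStructure`/`IsMorphism`), see the module docstring.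
[cite: Mochizuki2012, Rmk 3.4.3 (ii) p.83] -/
theorem S3RemarksLocal.AutHolSpaceNF.not_nfPointsFunctorial_model :
    let U : Opens ℂ := ⟨{z : ℂ | z ≠ 0 ∧ z ≠ 1}, isOpen_ne.inter isOpen_ne⟩
    let X : S3RemarksLocal.AutHolSpaceNF.{0} :=
      { carrier := ↥U, autHol := holAut U, nfPoints := {x | IsAlgebraic ℚ (x : ℂ)} }
    ¬ NFPointsFunctorial X X := by
  intro U X hNF
  obtain ⟨α, hcomm, x₃, hx₃, hαx₃⟩ :=
    AutHolSpaceNFWitness.exists_equivariant_push (U := U) rfl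
  -- `α` is an isomorphism of abstract Aut-holomorphic spaces in the typed sense
  have hIso : S3RemarksLocal.AutHolSpaceNF.IsIso X X α := by
    intro φ
    change φ ∈ holAut U ↔ (α.trans φ).trans α.symm ∈ holAut U
    have e : (α.trans φ).trans α.symm = α⁻¹ * φ * α := Homeomorph.ext fun _ => rfl
    rw [e]
    constructor
    · intro hφ
      have : α⁻¹ * φ * α = φ := by
        rw [mul_assoc, ← hcomm φ hφ, ← mul_assoc, inv_mul_cancel, one_mul]
      rw [this]; exact hφ
    · intro hψ
      have h2 := hcomm _ hψ
      have : φ = α⁻¹ * φ * α := by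
        calc φ = α * (α⁻¹ * φ * α) * α⁻¹ := by group
          _ = α⁻¹ * φ * α * α * α⁻¹ := by rw [h2]
          _ = α⁻¹ * φ * α := by group
      rw [this]; exact hψ
  -- hence, by the typed functoriality, `α` preserves NF-points — but it moves `3` off them
  have himg : α '' X.nfPoints = X.nfPoints := hNF α hIso
  have h3 : x₃ ∈ X.nfPoints := by
    change IsAlgebraic ℚ ((x₃ : U) : ℂ)
    rw [hx₃]
    have h := isAlgebraic_algebraMap (R := ℚ) (A := ℂ) 3
    rwa [map_ofNat] at h
  have h4 : α x₃ ∈ X.nfPoints := by rw [← himg]; exact ⟨x₃, h3, rfl⟩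
  change IsAlgebraic ℚ ((α x₃ : U) : ℂ) at h4
  rw [hαx₃] at h4
  exact AutHolSpaceNFWitness.not_isAlgebraic_push_value h4

/-- The refutation packaged as an existential over the interface: there is a GENUINE-model inhabitant
`X` of `S3RemarksLocal.AutHolSpaceNF` (the one of `nonempty_model`) with `¬ NFPointsFunctorial X X`.
[cite: Mochizuki2012, Rmk 3.4.3 (ii) p.83] -/
theorem S3RemarksLocal.AutHolSpaceNF.exists_model_not_nfPointsFunctorial :
    ∃ X : S3RemarksLocal.AutHolSpaceNF.{0},
      X = { carrier := ↥(⟨{z : ℂ | z ≠ 0 ∧ z ≠ 1}, isOpen_ne.inter isOpen_ne⟩ : Opens ℂ)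
            autHol := holAut (⟨{z : ℂ | z ≠ 0 ∧ z ≠ 1}, isOpen_ne.inter isOpen_ne⟩ : Opens ℂ)
            nfPoints := {x | IsAlgebraic ℚ (x : ℂ)} } ∧
      ¬ NFPointsFunctorial X X :=
  ⟨_, rfl, S3RemarksLocal.AutHolSpaceNF.not_nfPointsFunctorial_model⟩

end Literature.IUT.HodgeTheaters

end
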